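import Summits.NavierStokesRegularity.NavierStokesRegularity.Theorems.EfficiencyFloorNearSaturationNearMaximiserSeqCoreStretching
import HarnessLib

/-!
# Route `EfficiencyFloor`, crux `NearSaturationNearMaximiser` (stmt-NavierStokesRegularity-25482): CONTINUITY of the
# Lu–Doering functionals `Z, Pal, S` along `Ḣ¹ ∩ Ḣ²`-convergent sequences of admissible fields

Helper file (`--supports stmt-NavierStokesRegularity-25482`), analytic half (part 2) of the sequential core of stmt-25482
(`…SeqCore`): if admissible fields `u_n` with `Z(u_n) = Pal(u_n) = 1` converge to an admissible `w` in the sense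
`Z(u_n − w) → 0`, `Pal(u_n − w) → 0`, then `Z(w) = 1` (`enstrophy_eq_one_of_tendsto`, from the `L²` triangle inequality for
vorticities p839944), `Pal(w) = 1` (`palinstrophy_eq_one_of_tendsto`, via the AM–GM bound
`|Pal u − Pal w| ≤ (1/(2η))Pal(u−w) + η(Pal u + Pal w)`, §4) and `S(u_n) → S(w)` (`stretching_tendsto`, from the trilinear
bound of `…SeqCoreStretching`). Together with `…SeqCore` (`nearSaturationNearMaximiser_of_seqCore`) this reduces stmt-25482
to PRECOMPACTNESS MODULO TRANSLATIONS of normalised maximising sequences of the Lu–Doering functional.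

HONEST FRAMING: statements about HYPOTHETICAL convergent sequences; nothing about stmt-25482 or Navier–Stokes regularity is
decided; no summit statement is proved. [folklore]
-/

-- the problem directory repeats the summit name (`NavierStokesRegularity/NavierStokesRegularity`)
set_option linter.dupNamespace false

noncomputable section

namespace Summit.NavierStokesRegularity.NavierStokesRegularity.Theorems

namespace NearSaturationNearMaximiser

namespace SeqCore

open Set MeasureTheory Filter Topology Function
open scoped InnerProductSpace ENNReal NNReal
open Literature.Analysis.FluidPDE
open Magsanop2026Enstrophy (K6_nonneg slice_integrable integral_curl_pow_four_le)
open RigidExit.ReferenceShadowing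

/-! ## §4 The palinstrophy difference -/

/-- Scalar AM–GM step: for `p, q, r ≥ 0` with `|p − q| ≤ r` and `η > 0`, `|p² − q²| ≤ (1/(2η))·r² + η·(p² + q²)`. [folklore] -/
theorem abs_sq_sub_sq_le {p q r η : ℝ} (hp : 0 ≤ p) (hq : 0 ≤ q) (hr : |p - q| ≤ r) (hη : 0 < η) :
    |p ^ 2 - q ^ 2| ≤ 1 / (2 * η) * r ^ 2 + η * (p ^ 2 + q ^ 2) := by
  have hr0 : 0 ≤ r := (abs_nonneg _).trans hr
  have h1 : |p ^ 2 - q ^ 2| ≤ r * (p + q) := by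
    rw [show p ^ 2 - q ^ 2 = (p - q) * (p + q) by ring, abs_mul, abs_of_nonneg (by linarith : 0 ≤ p + q)]
    exact mul_le_mul_of_nonneg_right hr (by linarith)
  have h2 : 2 * η * (r * (p + q)) ≤ r ^ 2 + 2 * η ^ 2 * (p ^ 2 + q ^ 2) := by
    nlinarith [sq_nonneg (r - η * (p + q)), sq_nonneg (p - q)]
  have h3 : 2 * η * |p ^ 2 - q ^ 2| ≤ r ^ 2 + 2 * η ^ 2 * (p ^ 2 + q ^ 2) :=
    (mul_le_mul_of_nonneg_left h1 (by linarith)).trans h2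
  have h4 : 1 / (2 * η) * r ^ 2 + η * (p ^ 2 + q ^ 2) = (r ^ 2 + 2 * η ^ 2 * (p ^ 2 + q ^ 2)) / (2 * η) := by
    field_simp
  rw [h4, le_div_iff₀ (by positivity)]
  linarith

/-- **Frobenius squares of two operators**: `|‖A‖²_F − ‖B‖²_F| ≤ (1/(2η))·‖A − B‖²_F + η·(‖A‖²_F + ‖B‖²_F)` (`η > 0`). [folklore] -/
theorem abs_frobeniusNormSq_sub_le (A B : EuclideanSpace ℝ (Fin 3) →L[ℝ] EuclideanSpace ℝ (Fin 3)) {η : ℝ} (hη : 0 < η) :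
    |frobeniusNormSq A - frobeniusNormSq B| ≤
      1 / (2 * η) * frobeniusNormSq (A - B) + η * (frobeniusNormSq A + frobeniusNormSq B) := by
  unfold frobeniusNormSq
  rw [← Finset.sum_sub_distrib, ← Finset.sum_add_distrib, Finset.mul_sum, Finset.mul_sum, ← Finset.sum_add_distrib]
  refine (Finset.abs_sum_le_sum_abs _ _).trans (Finset.sum_le_sum fun i _ => ?_)
  have h : (A - B) (stdOrthonormalBasis ℝ (EuclideanSpace ℝ (Fin 3)) i) =
      A (stdOrthonormalBasis ℝ (EuclideanSpace ℝ (Fin 3)) i) - B (stdOrthonormalBasis ℝ (EuclideanSpace ℝ (Fin 3)) i) := rfl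
  rw [h]
  exact abs_sq_sub_sq_le (norm_nonneg _) (norm_nonneg _) (abs_norm_sub_norm_le _ _) hη

/-- **The palinstrophy difference**: for smooth fields with `D² ∈ L²` and every `η > 0`,
`|Pal(u) − Pal(w)| ≤ (1/(2η))·Pal(u − w) + η·(Pal(u) + Pal(w))`. [folklore] -/
theorem abs_palinstrophy_sub_le {u w : EuclideanSpace ℝ (Fin 3) → EuclideanSpace ℝ (Fin 3)} (hu : ContDiff ℝ (⊤ : ℕ∞) u)
    (hw : ContDiff ℝ (⊤ : ℕ∞) w) (hu2 : ∫⁻ x, ‖iteratedFDeriv ℝ 2 u x‖ₑ ^ 2 < ⊤)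
    (hw2 : ∫⁻ x, ‖iteratedFDeriv ℝ 2 w x‖ₑ ^ 2 < ⊤) {η : ℝ} (hη : 0 < η) :
    |(∫ x, frobeniusNormSq (fderiv ℝ (curl u) x)) - ∫ x, frobeniusNormSq (fderiv ℝ (curl w) x)| ≤
      1 / (2 * η) * (∫ x, frobeniusNormSq (fderiv ℝ (curl (u - w)) x)) +
        η * ((∫ x, frobeniusNormSq (fderiv ℝ (curl u) x)) + ∫ x, frobeniusNormSq (fderiv ℝ (curl w) x)) := by
  have hu3 : ContDiff ℝ 3 u := hu.of_le (by norm_cast)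
  have hw3 : ContDiff ℝ 3 w := hw.of_le (by norm_cast)
  have hd : ContDiff ℝ (⊤ : ℕ∞) (u - w) := hu.sub hw
  have hd2 := lintegral_iteratedFDeriv_sub_lt_top hu hw 2 hu2 hw2
  have hcu : ContDiff ℝ 1 (curl u) := contDiff_curl (n := 1) (hu.of_le (by norm_cast))
  have hcw : ContDiff ℝ 1 (curl w) := contDiff_curl (n := 1) (hw.of_le (by norm_cast))
  have hsub : curl (u - w) = fun x => curl u x - curl w x :=
    curl_sub_eq (hu.differentiable (by simp)) (hw.differentiable (by simp))
  have hfd : ∀ x, fderiv ℝ (curl (u - w)) x = fderiv ℝ (curl u) x - fderiv ℝ (curl w) x := fun x => by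
    rw [hsub]
    exact fderiv_fun_sub ((hcu.differentiable one_ne_zero) x) ((hcw.differentiable one_ne_zero) x)
  have Iu := (integrable_frobeniusNormSq_fderiv_curl hu3 hu2).1
  have Iw := (integrable_frobeniusNormSq_fderiv_curl hw3 hw2).1
  have Id := (integrable_frobeniusNormSq_fderiv_curl (hd.of_le (by norm_cast)) hd2).1
  rw [← integral_sub Iu Iw]
  calc |∫ x, (frobeniusNormSq (fderiv ℝ (curl u) x) - frobeniusNormSq (fderiv ℝ (curl w) x))|
      ≤ ∫ x, |frobeniusNormSq (fderiv ℝ (curl u) x) - frobeniusNormSq (fderiv ℝ (curl w) x)| :=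
        abs_integral_le_integral_abs
    _ ≤ ∫ x, (1 / (2 * η) * frobeniusNormSq (fderiv ℝ (curl (u - w)) x) +
          η * (frobeniusNormSq (fderiv ℝ (curl u) x) + frobeniusNormSq (fderiv ℝ (curl w) x))) := by
        refine integral_mono_of_nonneg (ae_of_all _ fun x => abs_nonneg _) ((Id.const_mul _).add ((Iu.add Iw).const_mul _))
          (ae_of_all _ fun x => ?_)
        show |frobeniusNormSq (fderiv ℝ (curl u) x) - frobeniusNormSq (fderiv ℝ (curl w) x)| ≤
          1 / (2 * η) * frobeniusNormSq (fderiv ℝ (curl (u - w)) x) +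
            η * (frobeniusNormSq (fderiv ℝ (curl u) x) + frobeniusNormSq (fderiv ℝ (curl w) x))
        rw [hfd x]
        exact abs_frobeniusNormSq_sub_le _ _ hη
    _ = 1 / (2 * η) * (∫ x, frobeniusNormSq (fderiv ℝ (curl (u - w)) x)) +
          η * ((∫ x, frobeniusNormSq (fderiv ℝ (curl u) x)) + ∫ x, frobeniusNormSq (fderiv ℝ (curl w) x)) := by
        have Iuw : Integrable (fun x => frobeniusNormSq (fderiv ℝ (curl u) x) + frobeniusNormSq (fderiv ℝ (curl w) x)) :=
          Iu.add Iw
        rw [integral_add (f := fun x => 1 / (2 * η) * frobeniusNormSq (fderiv ℝ (curl (u - w)) x))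
          (g := fun x => η * (frobeniusNormSq (fderiv ℝ (curl u) x) + frobeniusNormSq (fderiv ℝ (curl w) x)))
          (Id.const_mul _) (Iuw.const_mul _), integral_const_mul, integral_const_mul, integral_add Iu Iw]

/-! ## §5 Sequential consequences: the normalisation and the stretching pass to `Ḣ¹ ∩ Ḣ²` limits -/

/-- **Enstrophy of the limit.** If `Z(u_n) = 1` and `Z(u_n − w) → 0` (smooth fields, `D¹ ∈ L²`) then `Z(w) = 1`. [folklore] -/
theorem enstrophy_eq_one_of_tendsto {u : ℕ → EuclideanSpace ℝ (Fin 3) → EuclideanSpace ℝ (Fin 3)}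
    {w : EuclideanSpace ℝ (Fin 3) → EuclideanSpace ℝ (Fin 3)} (hu : ∀ n, ContDiff ℝ (⊤ : ℕ∞) (u n))
    (hu1 : ∀ n, ∫⁻ x, ‖iteratedFDeriv ℝ 1 (u n) x‖ₑ ^ 2 < ⊤) (hw : ContDiff ℝ (⊤ : ℕ∞) w)
    (hw1 : ∫⁻ x, ‖iteratedFDeriv ℝ 1 w x‖ₑ ^ 2 < ⊤) (hZ1 : ∀ n, (∫ x, ‖curl (u n) x‖ ^ 2) = 1)
    (hlim : Tendsto (fun n => ∫ x, ‖curl (u n - w) x‖ ^ 2) atTop (𝓝 0)) :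
    (∫ x, ‖curl w x‖ ^ 2) = 1 := by
  have h : ∀ n, |1 - Real.sqrt (∫ x, ‖curl w x‖ ^ 2)| ≤ Real.sqrt (∫ x, ‖curl (u n - w) x‖ ^ 2) := fun n => by
    have := sqrt_enstrophy_sub_le (hu n) (hu1 n) hw hw1
    rwa [hZ1 n, Real.sqrt_one] at this
  have hlim' : Tendsto (fun n => Real.sqrt (∫ x, ‖curl (u n - w) x‖ ^ 2)) atTop (𝓝 0) := by
    have := hlim.sqrt
    rwa [Real.sqrt_zero] at this
  have h0 : |1 - Real.sqrt (∫ x, ‖curl w x‖ ^ 2)| ≤ 0 := ge_of_tendsto' hlim' h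
  have h1 : Real.sqrt (∫ x, ‖curl w x‖ ^ 2) = 1 := by
    have := abs_nonpos_iff.1 h0
    linarith
  rwa [Real.sqrt_eq_one] at h1

/-- **Palinstrophy of the limit.** If `Pal(u_n) = 1` and `Pal(u_n − w) → 0` (smooth fields, `D² ∈ L²`) then `Pal(w) = 1`. [folklore] -/
theorem palinstrophy_eq_one_of_tendsto {u : ℕ → EuclideanSpace ℝ (Fin 3) → EuclideanSpace ℝ (Fin 3)}
    {w : EuclideanSpace ℝ (Fin 3) → EuclideanSpace ℝ (Fin 3)} (hu : ∀ n, ContDiff ℝ (⊤ : ℕ∞) (u n))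
    (hu2 : ∀ n, ∫⁻ x, ‖iteratedFDeriv ℝ 2 (u n) x‖ₑ ^ 2 < ⊤) (hw : ContDiff ℝ (⊤ : ℕ∞) w)
    (hw2 : ∫⁻ x, ‖iteratedFDeriv ℝ 2 w x‖ₑ ^ 2 < ⊤) (hP1 : ∀ n, (∫ x, frobeniusNormSq (fderiv ℝ (curl (u n)) x)) = 1)
    (hlim : Tendsto (fun n => ∫ x, frobeniusNormSq (fderiv ℝ (curl (u n - w)) x)) atTop (𝓝 0)) :
    (∫ x, frobeniusNormSq (fderiv ℝ (curl w) x)) = 1 := by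
  set Pw : ℝ := ∫ x, frobeniusNormSq (fderiv ℝ (curl w) x) with hPw
  have hPw0 : 0 ≤ Pw := integral_nonneg fun x => frobeniusNormSq_nonneg _
  -- for every `η > 0`: `|1 − Pal w| ≤ η (1 + Pal w)`
  have hη : ∀ η : ℝ, 0 < η → |1 - Pw| ≤ η * (1 + Pw) := by
    intro η hη
    have h : ∀ n, |1 - Pw| ≤ 1 / (2 * η) * (∫ x, frobeniusNormSq (fderiv ℝ (curl (u n - w)) x)) + η * (1 + Pw) :=
      fun n => by
        have := abs_palinstrophy_sub_le (hu n) hw (hu2 n) hw2 hη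
        rwa [hP1 n] at this
    have hl : Tendsto (fun n => 1 / (2 * η) * (∫ x, frobeniusNormSq (fderiv ℝ (curl (u n - w)) x)) + η * (1 + Pw))
        atTop (𝓝 (η * (1 + Pw))) := by
      have := (hlim.const_mul (1 / (2 * η))).add_const (η * (1 + Pw))
      rwa [mul_zero, zero_add] at this
    exact ge_of_tendsto' hl h
  -- hence `|1 − Pal w| = 0`
  by_contra hne
  have hpos : 0 < |1 - Pw| := abs_pos.2 (sub_ne_zero.2 (Ne.symm hne))
  have h := hη (|1 - Pw| / (2 * (1 + Pw))) (by positivity)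
  have h' : |1 - Pw| / (2 * (1 + Pw)) * (1 + Pw) = |1 - Pw| / 2 := by
    field_simp
  rw [h'] at h
  linarith

/-- The admissible class is closed under differences. [folklore] -/
theorem admissible_sub {v w : EuclideanSpace ℝ (Fin 3) → EuclideanSpace ℝ (Fin 3)}
    (hv : ContDiff ℝ (⊤ : ℕ∞) v ∧ VectorCalculus.IsDivFree v ∧ (∫⁻ x, ‖iteratedFDeriv ℝ 0 v x‖ₑ ^ 2 < ⊤) ∧
      (∫⁻ x, ‖iteratedFDeriv ℝ 1 v x‖ₑ ^ 2 < ⊤) ∧ (∫⁻ x, ‖iteratedFDeriv ℝ 2 v x‖ₑ ^ 2 < ⊤))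
    (hw : ContDiff ℝ (⊤ : ℕ∞) w ∧ VectorCalculus.IsDivFree w ∧ (∫⁻ x, ‖iteratedFDeriv ℝ 0 w x‖ₑ ^ 2 < ⊤) ∧
      (∫⁻ x, ‖iteratedFDeriv ℝ 1 w x‖ₑ ^ 2 < ⊤) ∧ (∫⁻ x, ‖iteratedFDeriv ℝ 2 w x‖ₑ ^ 2 < ⊤)) :
    ContDiff ℝ (⊤ : ℕ∞) (v - w) ∧ VectorCalculus.IsDivFree (v - w) ∧ (∫⁻ x, ‖iteratedFDeriv ℝ 0 (v - w) x‖ₑ ^ 2 < ⊤) ∧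
      (∫⁻ x, ‖iteratedFDeriv ℝ 1 (v - w) x‖ₑ ^ 2 < ⊤) ∧ (∫⁻ x, ‖iteratedFDeriv ℝ 2 (v - w) x‖ₑ ^ 2 < ⊤) :=
  ⟨hv.1.sub hw.1, hv.2.1.sub (hv.1.differentiable (by simp)) (hw.1.differentiable (by simp)) hw.2.1,
    lintegral_iteratedFDeriv_sub_lt_top hv.1 hw.1 0 hv.2.2.1 hw.2.2.1,
    lintegral_iteratedFDeriv_sub_lt_top hv.1 hw.1 1 hv.2.2.2.1 hw.2.2.2.1,
    lintegral_iteratedFDeriv_sub_lt_top hv.1 hw.1 2 hv.2.2.2.2 hw.2.2.2.2⟩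

/-- **Stretching of the limit.** Along admissible fields `u_n` normalised to `Z(u_n) = Pal(u_n) = 1` and converging to an
admissible `w` in `Ḣ¹ ∩ Ḣ²` (`Z(u_n − w) → 0`, `Pal(u_n − w) → 0`), the vortex stretching converges: `S(u_n) → S(w)`
(trilinear Hölder bound `abs_stretching_sub_le` + Ladyzhenskaya + `‖Dv‖₂ ≤ √Z(v)`). [folklore] -/
theorem stretching_tendsto {u : ℕ → EuclideanSpace ℝ (Fin 3) → EuclideanSpace ℝ (Fin 3)}
    {w : EuclideanSpace ℝ (Fin 3) → EuclideanSpace ℝ (Fin 3)}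
    (hu : ∀ n, ContDiff ℝ (⊤ : ℕ∞) (u n) ∧ VectorCalculus.IsDivFree (u n) ∧
      (∫⁻ x, ‖iteratedFDeriv ℝ 0 (u n) x‖ₑ ^ 2 < ⊤) ∧ (∫⁻ x, ‖iteratedFDeriv ℝ 1 (u n) x‖ₑ ^ 2 < ⊤) ∧
      (∫⁻ x, ‖iteratedFDeriv ℝ 2 (u n) x‖ₑ ^ 2 < ⊤))
    (hw : ContDiff ℝ (⊤ : ℕ∞) w ∧ VectorCalculus.IsDivFree w ∧ (∫⁻ x, ‖iteratedFDeriv ℝ 0 w x‖ₑ ^ 2 < ⊤) ∧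
      (∫⁻ x, ‖iteratedFDeriv ℝ 1 w x‖ₑ ^ 2 < ⊤) ∧ (∫⁻ x, ‖iteratedFDeriv ℝ 2 w x‖ₑ ^ 2 < ⊤))
    (hZ1 : ∀ n, (∫ x, ‖curl (u n) x‖ ^ 2) = 1) (hP1 : ∀ n, (∫ x, frobeniusNormSq (fderiv ℝ (curl (u n)) x)) = 1)
    (hZ : Tendsto (fun n => ∫ x, ‖curl (u n - w) x‖ ^ 2) atTop (𝓝 0))
    (hP : Tendsto (fun n => ∫ x, frobeniusNormSq (fderiv ℝ (curl (u n - w)) x)) atTop (𝓝 0)) :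
    Tendsto (fun n => ∫ x, ⟪curl (u n) x, fderiv ℝ (u n) x (curl (u n) x)⟫_ℝ) atTop
      (𝓝 (∫ x, ⟪curl w x, fderiv ℝ w x (curl w x)⟫_ℝ)) := by
  set K : ℝ := (SNormLESNormFDerivOfEqConst (EuclideanSpace ℝ (Fin 3)) (volume : Measure (EuclideanSpace ℝ (Fin 3))) 2 : ℝ)
    with hK
  have hK0 : 0 ≤ K := K6_nonneg
  set Zw : ℝ := ∫ x, ‖curl w x‖ ^ 2 with hZw
  set Pw : ℝ := ∫ x, frobeniusNormSq (fderiv ℝ (curl w) x) with hPw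
  set Zd : ℕ → ℝ := fun n => ∫ x, ‖curl (u n - w) x‖ ^ 2 with hZd
  set Pd : ℕ → ℝ := fun n => ∫ x, frobeniusNormSq (fderiv ℝ (curl (u n - w)) x) with hPd
  have hd : ∀ n, ContDiff ℝ (⊤ : ℕ∞) (u n - w) ∧ VectorCalculus.IsDivFree (u n - w) ∧
      (∫⁻ x, ‖iteratedFDeriv ℝ 0 (u n - w) x‖ₑ ^ 2 < ⊤) ∧ (∫⁻ x, ‖iteratedFDeriv ℝ 1 (u n - w) x‖ₑ ^ 2 < ⊤) ∧
      (∫⁻ x, ‖iteratedFDeriv ℝ 2 (u n - w) x‖ₑ ^ 2 < ⊤) := fun n => admissible_sub (hu n) hw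
  -- the bounds on the ingredients
  set CW : ℝ := K ^ 3 * Real.sqrt Zw * (Pw * Real.sqrt Pw) with hCW
  set d : ℕ → ℝ := fun n => K ^ 3 * Real.sqrt (Zd n) * (Pd n * Real.sqrt (Pd n)) with hdd
  have hV4 : ∀ n, ∫ x, ‖curl (u n) x‖ ^ 4 ≤ K ^ 3 := fun n => by
    have h := integral_curl_pow_four_le' (hu n).1 (hu n).2.2.2.1 (hu n).2.2.2.2
    rw [hZ1 n, hP1 n, Real.sqrt_one, mul_one, one_mul, mul_one] at h
    exact h
  have hW4 : ∫ x, ‖curl w x‖ ^ 4 ≤ CW := integral_curl_pow_four_le' hw.1 hw.2.2.2.1 hw.2.2.2.2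
  have hD4 : ∀ n, ∫ x, ‖curl (u n - w) x‖ ^ 4 ≤ d n := fun n =>
    integral_curl_pow_four_le' (hd n).1 (hd n).2.2.2.1 (hd n).2.2.2.2
  have hGV : ∀ n, ∫ x, ‖fderiv ℝ (u n) x‖ ^ 2 ≤ 1 := fun n => (integral_norm_fderiv_sq_le_enstrophy (hu n)).trans_eq (hZ1 n)
  have hGW : ∫ x, ‖fderiv ℝ w x‖ ^ 2 ≤ Zw := integral_norm_fderiv_sq_le_enstrophy hw
  have hGD : ∀ n, ∫ x, ‖fderiv ℝ (u n - w) x‖ ^ 2 ≤ Zd n := fun n => integral_norm_fderiv_sq_le_enstrophy (hd n)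
  -- the envelope `E n` of `|S(u n) − S(w)|`
  set E : ℕ → ℝ := fun n => Real.sqrt (Real.sqrt (d n) * Real.sqrt (K ^ 3)) * Real.sqrt 1 +
    Real.sqrt (Real.sqrt CW * Real.sqrt (K ^ 3)) * Real.sqrt (Zd n) +
    Real.sqrt (Real.sqrt CW * Real.sqrt (d n)) * Real.sqrt Zw with hE
  have hbound : ∀ n, |(∫ x, ⟪curl (u n) x, fderiv ℝ (u n) x (curl (u n) x)⟫_ℝ) -
      ∫ x, ⟪curl w x, fderiv ℝ w x (curl w x)⟫_ℝ| ≤ E n := fun n => by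
    have h := abs_stretching_sub_le (hu n).1 (hu n).2.2.2.1 (hu n).2.2.2.2 hw.1 hw.2.2.2.1 hw.2.2.2.2
    refine h.trans (add_le_add (add_le_add ?_ ?_) ?_)
    · exact mul_le_mul (Real.sqrt_le_sqrt (mul_le_mul (Real.sqrt_le_sqrt (hD4 n)) (Real.sqrt_le_sqrt (hV4 n))
        (Real.sqrt_nonneg _) (Real.sqrt_nonneg _))) (Real.sqrt_le_sqrt (hGV n)) (Real.sqrt_nonneg _) (Real.sqrt_nonneg _)
    · exact mul_le_mul (Real.sqrt_le_sqrt (mul_le_mul (Real.sqrt_le_sqrt hW4) (Real.sqrt_le_sqrt (hV4 n))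
        (Real.sqrt_nonneg _) (Real.sqrt_nonneg _))) (Real.sqrt_le_sqrt (hGD n)) (Real.sqrt_nonneg _) (Real.sqrt_nonneg _)
    · exact mul_le_mul (Real.sqrt_le_sqrt (mul_le_mul (Real.sqrt_le_sqrt hW4) (Real.sqrt_le_sqrt (hD4 n))
        (Real.sqrt_nonneg _) (Real.sqrt_nonneg _))) (Real.sqrt_le_sqrt hGW) (Real.sqrt_nonneg _) (Real.sqrt_nonneg _)
  -- `E n → 0`
  have hdlim : Tendsto d atTop (𝓝 0) := by
    have h := ((tendsto_const_nhds (x := K ^ 3)).mul hZ.sqrt).mul (hP.mul hP.sqrt)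
    simp only [Real.sqrt_zero, mul_zero] at h
    exact h
  have hElim : Tendsto E atTop (𝓝 0) := by
    have h1 : Tendsto (fun n => Real.sqrt (Real.sqrt (d n) * Real.sqrt (K ^ 3)) * Real.sqrt 1) atTop (𝓝 0) := by
      have h := ((hdlim.sqrt.mul (tendsto_const_nhds (x := Real.sqrt (K ^ 3)))).sqrt).mul
        (tendsto_const_nhds (x := Real.sqrt 1))
      simp only [Real.sqrt_zero, zero_mul] at h
      exact h
    have h2 : Tendsto (fun n => Real.sqrt (Real.sqrt CW * Real.sqrt (K ^ 3)) * Real.sqrt (Zd n)) atTop (𝓝 0) := by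
      have h := (tendsto_const_nhds (x := Real.sqrt (Real.sqrt CW * Real.sqrt (K ^ 3)))).mul hZ.sqrt
      simp only [Real.sqrt_zero, mul_zero] at h
      exact h
    have h3 : Tendsto (fun n => Real.sqrt (Real.sqrt CW * Real.sqrt (d n)) * Real.sqrt Zw) atTop (𝓝 0) := by
      have h := (((tendsto_const_nhds (x := Real.sqrt CW)).mul hdlim.sqrt).sqrt).mul
        (tendsto_const_nhds (x := Real.sqrt Zw))
      simp only [Real.sqrt_zero, mul_zero, zero_mul] at h
      exact h
    have h := (h1.add h2).add h3
    simp only [add_zero] at h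
    exact h
  -- squeeze
  have h0 : Tendsto (fun n => (∫ x, ⟪curl (u n) x, fderiv ℝ (u n) x (curl (u n) x)⟫_ℝ) -
      ∫ x, ⟪curl w x, fderiv ℝ w x (curl w x)⟫_ℝ) atTop (𝓝 0) :=
    squeeze_zero_norm (fun n => by rw [Real.norm_eq_abs]; exact hbound n) hElim
  exact tendsto_sub_nhds_zero_iff.1 h0

end SeqCore

end NearSaturationNearMaximiser

end Summit.NavierStokesRegularity.NavierStokesRegularity.Theorems

end
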